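import Summits.BirchSwinnertonDyer.BirchSwinnertonDyer.Theorems.ThetaPartnerAtTwoSignedControlAtTwoKleinFourModule
import Literature.NumberTheory.GaloisRepresentations.RestrictionOpenSubgroupIndex
import Literature.NumberTheory.GaloisRepresentations.ShapiroIsomorphism
import Literature.NumberTheory.GaloisRepresentations.ContinuousCohomologyTransport
import Literature.NumberTheory.GaloisRepresentations.CohomologicalDimension
import Literature.NumberTheory.GaloisRepresentations.ContinuousH3
import HarnessLib

/-!
# `H³(G, V) = 0` for a Klein four-group module `V` without fixed points, above `cd₂` of the kernel
# (K4 `SignedControlAtTwo`, archimedean row at the consumed module `E[2]`, file 2/3)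

Crux K4 `SignedControlAtTwo` (stmt-BirchSwinnertonDyer-20309), line `eulerchar` v12; width seat `bsd-wall-tp2-p3-w3` g8
(`--supports stmt-BirchSwinnertonDyer-20309`, helper).  Sequel to `…KleinFourModule.lean`.

Let `G` be a profinite group acting continuously on a discrete Klein four-group `V = {0, P₁, P₂, P₁ + P₂}` (`2V = 0`), with
kernel `N = ker(G → Aut V)`.  Suppose (no fixed point) no non-zero vector of `V` is fixed by all of `G` — so the stabiliser
`S = Stab_G(P₁ + P₂)` is an open subgroup of index `3` (`index_stabilizerSubgroup_eq_three`) — and (a transposition) some `τ ∈ G`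
swaps `P₁` and `P₂` — so `S = N ⊔ N τ` and `V|_S` is the PERMUTATION module of the `S`-set `{P₁, P₂} ≅ N\S`, i.e. Serre's induced
module `M_S^N(𝔽₂)` of the trivial `N`-module `𝔽₂` (`coindRep`, `CoinducedModule.lean`); precisely (§2) `Φ : V → M_S^N(𝔽₂)`,
`m ↦ (s ↦ λ(s m))`, and `Ψ : a* ↦ a*(1) P₁ + a*(τ) P₂` are `S`-equivariant with `Ψ ∘ Φ = id`.

Then (**`subsingleton_H_three_of_kleinFour`**, §3): **if `cd₂(N) ≤ 2` then `H³(G, V) = 0`.**  Proof: `H^q(N, 𝔽₂) = 0` for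
`q > 2`; by Shapiro's lemma (`shapiroAddEquiv`, Serre I §2.5 Prop. 10) `H^q(S, M_S^N(𝔽₂)) = 0`, hence its retract `H^q(S, V) = 0`
(`subsingleton_H_restrict_stabilizer`, transport `ContinuousCohomologyTransport`); so the restriction of any `x ∈ H³(G, V)` to `S`
vanishes and `3x = (G : S) x = 0` (Serre I §2.4 Prop. 9, the tree's `index_smul_eq_zero_of_Hpullback_eq_zero_int`); and `2x = 0`
because `2V = 0` (§1, via the inhomogeneous `3`-cocycles of `ContinuousH3.lean`); so `x = 0`.

Application (file 3/3, `…ArchMovesTwoTorsion*`): `G = Γ_ℚ`, `V = E[2]` for `E/ℚ` with `E(ℚ)[2] = 0` and complex conjugation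
acting non-trivially; then `N = Gal(ℚ̄/ℚ(E[2]))` with `ℚ(E[2])` totally complex, `cd₂(N) ≤ 2` (Serre II §4.4 Prop. 13, tree theorem
`fieldCdLE_two_of_numberField_holds`) and `H³(ℚ, E[2]) = 0` — the instance of Milne I 4.10 (c) the K4 line consumes.
Universe: `G, M : Type` (as in `RestrictionOpenSubgroupIndex.lean`, whose class-level Prop. 9 is consumed).
HONEST FRAMING: THEOREMS and auxiliary definitions with bodies only (no named fact, no instance, no `sorry`); generic in `G`;
closes no item; BSD is not proved by any of this.

References: [SerreGaloisCohomology1997] I §2.2, §2.4 Prop. 9, §2.5 Prop. 10, II §4.4 Prop. 13; [MilneADT2006] I Thm. 4.10 (c).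
-/

set_option autoImplicit false
-- the Theorems namespace of this sub repeats the summit name by design (D-0017 nested layout)
set_option linter.dupNamespace false

noncomputable section

open CategoryTheory

namespace Summit.BirchSwinnertonDyer.BirchSwinnertonDyer.Theorems.SignedEC.KleinFour

open _root_.TopRep _root_.ContRepresentation _root_.ContinuousCohomology
open Literature.NumberTheory.GaloisRepresentations

/-! ## §1 `2 · H³(G, X) = 0` when `2 · X = 0` -/

section TwoTorsion

variable {G : Type} [Group G] [TopologicalSpace G] [IsTopologicalGroup G] [LocallyCompactSpace G]

/-- **`n · X = 0 ⟹ n · H³(G, X) = 0`**: every class is the class of a continuous inhomogeneous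
`3`-cocycle (`threeCocycleClass_surjective`) and `n · f = 0` pointwise (degree-`3` twin of the tree's
`nsmul_continuousCohomology_two_eq_zero_of_forall`). [cite: SerreGaloisCohomology1997, I §2.2] -/
theorem nsmul_continuousCohomology_three_eq_zero_of_forall (X : TopRep.{0} ℤ G) {n : ℕ}
    (hX : ∀ x : X, n • x = 0) (c : continuousCohomology 3 X) : n • c = 0 := by
  obtain ⟨f, rfl⟩ := threeCocycleClass_surjective X c
  have hf : n • f = 0 := by
    refine Subtype.ext (ContinuousMap.ext fun p => ?_)
    change n • f.1 p = 0
    exact hX _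
  rw [← threeCocycleClassₗ_apply, ← map_nsmul, hf, map_zero]

end TwoTorsion

/-! ## §2 `V|_S ≅ M_S^N(𝔽₂)`: the stabiliser-module is coinduced from the kernel -/

section Coind

variable {G : Type} [Group G] [TopologicalSpace G] [IsTopologicalGroup G] [CompactSpace G] [T2Space G]
  [TotallyDisconnectedSpace G]
variable {M : Type} [AddCommGroup M] [TopologicalSpace M] [DiscreteTopology M]
variable (ρ : ContinuousRep G ℤ M) {P₁ P₂ : M}

/-- The kernel `N` viewed inside the stabiliser `S = Stab(P₁ + P₂)`. [folklore] -/
def kerInStab (P : M) : Subgroup (stabilizerSubgroup ρ P) :=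
  ρ.ker.subgroupOf (stabilizerSubgroup ρ P)

omit [IsTopologicalGroup G] [CompactSpace G] [T2Space G] [TotallyDisconnectedSpace G] [DiscreteTopology M] in
/-- Membership in `kerInStab`. [folklore] -/
theorem mem_kerInStab_iff (P : M) (s : stabilizerSubgroup ρ P) :
    s ∈ kerInStab ρ P ↔ ∀ m, ρ (s : G) m = m := by
  rw [kerInStab, Subgroup.mem_subgroupOf, mem_ker_iff_forall]

omit [IsTopologicalGroup G] [CompactSpace G] [T2Space G] [TotallyDisconnectedSpace G] in
/-- `N ≤ S` is closed in `S`. [folklore] -/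
theorem isClosed_kerInStab (P : M) : IsClosed (kerInStab ρ P : Set (stabilizerSubgroup ρ P)) :=
  ρ.isClosed_ker.preimage continuous_subtype_val

omit [T2Space G] [TotallyDisconnectedSpace G] in
/-- The open subgroup `S = Stab(P)` of the compact group `G` is compact. [folklore] -/
theorem compactSpace_stabilizerSubgroup (P : M) : CompactSpace (stabilizerSubgroup ρ P) :=
  isCompact_iff_compactSpace.mp
    (Subgroup.isClosed_of_isOpen _ (isOpen_stabilizerSubgroup ρ P)).isCompact

/-- The trivial `N`-module `𝔽₂ = ℤ/2`. [folklore] -/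
abbrev trivKer (P : M) : ContinuousRep (kerInStab ρ P) ℤ (ZMod 2) :=
  ContinuousRep.trivial _ _ _

/-- **The comparison map `Φ : V → M_S^N(𝔽₂)`, `m ↦ (s ↦ λ(s m))`** (continuous in `s`, constant on
`N`-cosets). [cite: SerreGaloisCohomology1997, I §2.5] -/
def toCoind (h : IsKleinFour M P₁ P₂) (m : M) : coindModule (trivKer ρ (P₁ + P₂)) :=
  ⟨⟨fun s => lam h (ρ (s : G) m),
    (continuous_of_discreteTopology (f := lam h)).comp
      ((ρ.continuous_apply_left m).comp continuous_subtype_val)⟩,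
    (mem_coind_iff _ _).2 fun t x => by
      change lam h (ρ ((t : stabilizerSubgroup ρ (P₁ + P₂)) * x : stabilizerSubgroup ρ (P₁ + P₂)) m) =
        lam h (ρ (x : G) m)
      rw [Subgroup.coe_mul, map_mul, Module.End.mul_apply, (mem_kerInStab_iff ρ _ _).1 t.2]⟩

omit [IsTopologicalGroup G] [CompactSpace G] [T2Space G] [TotallyDisconnectedSpace G] in
/-- Unfolding `toCoind`. [folklore] -/
@[simp] theorem toCoind_apply (h : IsKleinFour M P₁ P₂) (m : M) (s : stabilizerSubgroup ρ (P₁ + P₂)) :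
    ((toCoind ρ h m : coindModule (trivKer ρ (P₁ + P₂))) : C(stabilizerSubgroup ρ (P₁ + P₂), ZMod 2)) s =
      lam h (ρ (s : G) m) := rfl

omit [IsTopologicalGroup G] [CompactSpace G] [T2Space G] [TotallyDisconnectedSpace G] in
/-- `Φ` is additive. [folklore] -/
theorem toCoind_add (h : IsKleinFour M P₁ P₂) (m m' : M) :
    toCoind ρ h (m + m') = toCoind ρ h m + toCoind ρ h m' :=
  Subtype.ext (ContinuousMap.ext fun s => by
    change lam h (ρ (s : G) (m + m')) = lam h (ρ (s : G) m) + lam h (ρ (s : G) m')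
    rw [map_add, map_add])

omit [CompactSpace G] [T2Space G] [TotallyDisconnectedSpace G] in
/-- **`Φ` is `S`-equivariant**: `Φ(g m) = g · Φ(m)` for the action `(g a*)(x) = a*(x g)` of `coindRep`.
[cite: SerreGaloisCohomology1997, I §2.5] -/
theorem coindRep_toCoind [CompactSpace (stabilizerSubgroup ρ (P₁ + P₂))] (h : IsKleinFour M P₁ P₂)
    (g : stabilizerSubgroup ρ (P₁ + P₂)) (m : M) :
    coindRep (trivKer ρ (P₁ + P₂)) g (toCoind ρ h m) = toCoind ρ h (ρ (g : G) m) :=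
  Subtype.ext (ContinuousMap.ext fun x => by
    rw [coindRep_apply_apply, toCoind_apply, toCoind_apply, Subgroup.coe_mul, map_mul,
      Module.End.mul_apply])

/-- **The inverse comparison `Ψ : M_S^N(𝔽₂) → V`**, `a* ↦ a*(1) · P₁ + a*(τ) · P₂` (reading the two
`N`-cosets `N`, `N τ` of `S`). [cite: SerreGaloisCohomology1997, I §2.5] -/
def ofCoind (P₁ P₂ : M) (τS : stabilizerSubgroup ρ (P₁ + P₂)) (f : coindModule (trivKer ρ (P₁ + P₂))) : M :=
  ((f : C(stabilizerSubgroup ρ (P₁ + P₂), ZMod 2)) 1).val • P₁ +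
    ((f : C(stabilizerSubgroup ρ (P₁ + P₂), ZMod 2)) τS).val • P₂

omit [TopologicalSpace M] in
/-- `(a + b).val • m = a.val • m + b.val • m` in `ℤ/2` when `2m = 0`. [folklore] -/
theorem val_add_nsmul (h : IsKleinFour M P₁ P₂) (a b : ZMod 2) (m : M) :
    (a + b).val • m = a.val • m + b.val • m := by
  letI : Module (ZMod 2) M := AddCommGroup.zmodModule h.two_nsmul
  have key : ∀ c : ZMod 2, c.val • m = c • m := fun c => rfl
  rw [key, key, key, add_smul]

omit [IsTopologicalGroup G] [CompactSpace G] [T2Space G] [TotallyDisconnectedSpace G] [DiscreteTopology M] in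
/-- `Ψ` is additive. [folklore] -/
theorem ofCoind_add (h : IsKleinFour M P₁ P₂) (τS : stabilizerSubgroup ρ (P₁ + P₂))
    (f f' : coindModule (trivKer ρ (P₁ + P₂))) :
    ofCoind ρ P₁ P₂ τS (f + f') = ofCoind ρ P₁ P₂ τS f + ofCoind ρ P₁ P₂ τS f' := by
  simp only [ofCoind, Submodule.coe_add, ContinuousMap.add_apply, val_add_nsmul h]
  abel

omit [IsTopologicalGroup G] [CompactSpace G] [T2Space G] [TotallyDisconnectedSpace G] in
/-- **`Ψ ∘ Φ = id`.** [folklore] -/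
theorem ofCoind_toCoind (h : IsKleinFour M P₁ P₂) {τ : G} (hτ₁ : ρ τ P₁ = P₂) (hτ₂ : ρ τ P₂ = P₁)
    (m : M) :
    ofCoind ρ P₁ P₂ ⟨τ, mem_stabilizer_of_swap ρ hτ₁ hτ₂⟩ (toCoind ρ h m) = m := by
  obtain ⟨h0, h1, h2, h3⟩ := lamFun_values h
  have v0 : (0 : ZMod 2).val = 0 := rfl
  have v1 : (1 : ZMod 2).val = 1 := rfl
  simp only [ofCoind, toCoind_apply, Subgroup.coe_one, map_one, Module.End.one_apply, lam_apply]
  rcases h.eq_or m with rfl | rfl | rfl | rfl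
  · simp only [map_zero, h0, v0, zero_nsmul, add_zero]
  · simp only [h1, hτ₁, h2, v0, v1, one_nsmul, zero_nsmul, add_zero]
  · simp only [h2, hτ₂, h1, v0, v1, one_nsmul, zero_nsmul, zero_add]
  · rw [map_add, hτ₁, hτ₂, add_comm P₂ P₁]
    simp only [h3, v1, one_nsmul]

omit [CompactSpace G] [T2Space G] [TotallyDisconnectedSpace G] [DiscreteTopology M] in
/-- **`Ψ` is `S`-equivariant** (via the dichotomy on `S`: an element of `S` lies in `N` or in `N τ`).
[cite: SerreGaloisCohomology1997, I §2.5] -/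
theorem ofCoind_coindRep [CompactSpace (stabilizerSubgroup ρ (P₁ + P₂))] (h : IsKleinFour M P₁ P₂) {τ : G}
    (hτ₁ : ρ τ P₁ = P₂) (hτ₂ : ρ τ P₂ = P₁) (g : stabilizerSubgroup ρ (P₁ + P₂)) (f : coindModule (trivKer ρ (P₁ + P₂))) :
    ofCoind ρ P₁ P₂ ⟨τ, mem_stabilizer_of_swap ρ hτ₁ hτ₂⟩ (coindRep (trivKer ρ (P₁ + P₂)) g f) =
      ρ (g : G) (ofCoind ρ P₁ P₂ ⟨τ, mem_stabilizer_of_swap ρ hτ₁ hτ₂⟩ f) := by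
  set τS : stabilizerSubgroup ρ (P₁ + P₂) := ⟨τ, mem_stabilizer_of_swap ρ hτ₁ hτ₂⟩ with hτS
  -- `f` is constant on left `N`-cosets
  have hf : ∀ (t : stabilizerSubgroup ρ (P₁ + P₂)), (∀ m, ρ (t : G) m = m) →
      ∀ x, (f : C(stabilizerSubgroup ρ (P₁ + P₂), ZMod 2)) (t * x) =
        (f : C(stabilizerSubgroup ρ (P₁ + P₂), ZMod 2)) x := fun t ht x => by
    have := (mem_coind_iff (trivKer ρ (P₁ + P₂)) _).1 f.2 ⟨t, (mem_kerInStab_iff ρ _ t).2 ht⟩ x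
    rwa [ContinuousRep.trivial_apply] at this
  have hτ2 : ∀ m, ρ ((τS * τS : stabilizerSubgroup ρ (P₁ + P₂)) : G) m = m := by
    rw [← mem_ker_iff_forall]
    refine mem_ker_of_apply_eq ρ h ?_ ?_
    · rw [Subgroup.coe_mul, map_mul, Module.End.mul_apply, hτ₁, hτ₂]
    · rw [Subgroup.coe_mul, map_mul, Module.End.mul_apply, hτ₂, hτ₁]
  have hτi₁ : ρ (τ⁻¹ : G) P₁ = P₂ := by
    rw [← hτ₂, ← Module.End.mul_apply, ← map_mul, inv_mul_cancel, map_one, Module.End.one_apply]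
  have hτi₂ : ρ (τ⁻¹ : G) P₂ = P₁ := by
    rw [← hτ₁, ← Module.End.mul_apply, ← map_mul, inv_mul_cancel, map_one, Module.End.one_apply]
  simp only [ofCoind, coindRep_apply_apply, one_mul, map_add, map_nsmul]
  rcases apply_eq_or_of_mem_stabilizer ρ h g.2 with ⟨hg₁, hg₂⟩ | ⟨hg₁, hg₂⟩
  · -- `g ∈ N`
    have hgN : ∀ m, ρ (g : G) m = m :=
      (mem_ker_iff_forall ρ _).1 (mem_ker_of_apply_eq ρ h hg₁ hg₂)
    have e1 : (f : C(stabilizerSubgroup ρ (P₁ + P₂), ZMod 2)) g =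
        (f : C(stabilizerSubgroup ρ (P₁ + P₂), ZMod 2)) 1 := by
      rw [← mul_one g, hf g hgN]
    have e2 : (f : C(stabilizerSubgroup ρ (P₁ + P₂), ZMod 2)) (τS * g) =
        (f : C(stabilizerSubgroup ρ (P₁ + P₂), ZMod 2)) τS := by
      have hc : τS * g = (τS * g * τS⁻¹) * τS := by group
      rw [hc, hf (τS * g * τS⁻¹) ?_]
      intro m
      rw [Subgroup.coe_mul, Subgroup.coe_mul, Subgroup.coe_inv, map_mul, map_mul, Module.End.mul_apply,
        Module.End.mul_apply, hgN, ← Module.End.mul_apply, ← map_mul, mul_inv_cancel, map_one,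
        Module.End.one_apply]
    rw [e1, e2, hg₁, hg₂]
  · -- `g ∈ N τ`: `t = g τ⁻¹ ∈ N`
    have ht : ∀ m, ρ ((g * τS⁻¹ : stabilizerSubgroup ρ (P₁ + P₂)) : G) m = m := by
      rw [← mem_ker_iff_forall]
      refine mem_ker_of_apply_eq ρ h ?_ ?_
      · rw [Subgroup.coe_mul, Subgroup.coe_inv, map_mul, Module.End.mul_apply, hτi₁, hg₂]
      · rw [Subgroup.coe_mul, Subgroup.coe_inv, map_mul, Module.End.mul_apply, hτi₂, hg₁]
    have e1 : (f : C(stabilizerSubgroup ρ (P₁ + P₂), ZMod 2)) g =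
        (f : C(stabilizerSubgroup ρ (P₁ + P₂), ZMod 2)) τS := by
      have hc : g = (g * τS⁻¹) * τS := by group
      conv_lhs => rw [hc]
      rw [hf _ ht]
    have e2 : (f : C(stabilizerSubgroup ρ (P₁ + P₂), ZMod 2)) (τS * g) =
        (f : C(stabilizerSubgroup ρ (P₁ + P₂), ZMod 2)) 1 := by
      have hc : τS * g = (τS * (g * τS⁻¹) * τS⁻¹) * ((τS * τS) * 1) := by group
      rw [hc, hf (τS * (g * τS⁻¹) * τS⁻¹) ?_, hf (τS * τS) hτ2]
      intro m
      rw [Subgroup.coe_mul, Subgroup.coe_mul, Subgroup.coe_inv, map_mul, map_mul, Module.End.mul_apply,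
        Module.End.mul_apply, ht, ← Module.End.mul_apply, ← map_mul, mul_inv_cancel, map_one,
        Module.End.one_apply]
    rw [e1, e2, hg₁, hg₂, add_comm]

end Coind

/-! ## §3 `H^q(S, V) = 0` above `cd₂(N)` (Shapiro), and `H³(G, V) = 0` -/

section Main

variable {G : Type} [Group G] [TopologicalSpace G] [IsTopologicalGroup G] [CompactSpace G] [T2Space G]
  [TotallyDisconnectedSpace G]
variable {M : Type} [AddCommGroup M] [TopologicalSpace M] [DiscreteTopology M]
variable (ρ : ContinuousRep G ℤ M) {P₁ P₂ : M}

/-- `Φ` as a morphism of topological `S`-modules `V|_S ⟶ M_S^N(𝔽₂)` (over the identity of `S`, written as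
restriction along `(refl S)⁻¹` for the transport lemma). [cite: SerreGaloisCohomology1997, I §2.5] -/
def toCoindHom [CompactSpace (stabilizerSubgroup ρ (P₁ + P₂))] (h : IsKleinFour M P₁ P₂) :
    TopRep.res (((ContinuousMulEquiv.refl (stabilizerSubgroup ρ (P₁ + P₂))).symm :
        stabilizerSubgroup ρ (P₁ + P₂) →ₜ* stabilizerSubgroup ρ (P₁ + P₂)) :
        stabilizerSubgroup ρ (P₁ + P₂) →* stabilizerSubgroup ρ (P₁ + P₂))
      (ρ.restrict (subgroupIncl (stabilizerSubgroup ρ (P₁ + P₂)))).toTopRep ⟶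
      (coindRep (trivKer ρ (P₁ + P₂))).toTopRep :=
  TopRep.ofHom
    { toLinearMap :=
        ({ toFun := toCoind ρ h
           map_zero' := by
             refine Subtype.ext (ContinuousMap.ext fun s => ?_)
             rw [toCoind_apply, map_zero, map_zero]
             rfl
           map_add' := toCoind_add ρ h } : M →+ coindModule (trivKer ρ (P₁ + P₂))).toIntLinearMap
      cont := continuous_of_discreteTopology
      isIntertwining' := fun g => ContinuousLinearMap.ext fun m => (coindRep_toCoind ρ h g m).symm }

/-- `Ψ` as a morphism of topological `S`-modules `M_S^N(𝔽₂) ⟶ V|_S`. [cite: SerreGaloisCohomology1997, I §2.5] -/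
def ofCoindHom [CompactSpace (stabilizerSubgroup ρ (P₁ + P₂))] (h : IsKleinFour M P₁ P₂) {τ : G}
    (hτ₁ : ρ τ P₁ = P₂) (hτ₂ : ρ τ P₂ = P₁) :
    TopRep.res (((ContinuousMulEquiv.refl (stabilizerSubgroup ρ (P₁ + P₂))) :
        stabilizerSubgroup ρ (P₁ + P₂) →ₜ* stabilizerSubgroup ρ (P₁ + P₂)) :
        stabilizerSubgroup ρ (P₁ + P₂) →* stabilizerSubgroup ρ (P₁ + P₂))
      (coindRep (trivKer ρ (P₁ + P₂))).toTopRep ⟶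
      (ρ.restrict (subgroupIncl (stabilizerSubgroup ρ (P₁ + P₂)))).toTopRep :=
  TopRep.ofHom
    { toLinearMap :=
        ({ toFun := ofCoind ρ P₁ P₂ ⟨τ, mem_stabilizer_of_swap ρ hτ₁ hτ₂⟩
           map_zero' := by simp only [ofCoind, Submodule.coe_zero, ContinuousMap.zero_apply, ZMod.val_zero,
             zero_nsmul, add_zero]
           map_add' := ofCoind_add ρ h _ } : coindModule (trivKer ρ (P₁ + P₂)) →+ M).toIntLinearMap
      cont := by
        haveI := discreteTopology_coind (trivKer ρ (P₁ + P₂))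
        exact continuous_of_discreteTopology
      isIntertwining' := fun g => ContinuousLinearMap.ext fun f => ofCoind_coindRep ρ h hτ₁ hτ₂ g f }

omit [IsTopologicalGroup G] [CompactSpace G] [T2Space G] [TotallyDisconnectedSpace G] [DiscreteTopology M] in
/-- `N ≃ₜ* (N viewed in S)`. [folklore] -/
def kerEquivKerInStab (P : M) : ρ.ker ≃ₜ* kerInStab ρ P :=
  { (Subgroup.subgroupOfEquivOfLe (ker_le_stabilizerSubgroup ρ P)).symm with
    continuous_toFun := by
      apply Continuous.subtype_mk
      apply Continuous.subtype_mk
      exact continuous_subtype_val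
    continuous_invFun := by
      apply Continuous.subtype_mk
      exact continuous_subtype_val.comp continuous_subtype_val }

/-- `ℤ/2` is `2`-primary torsion. [folklore] -/
theorem isPrimaryTorsion_zmod_two : IsPrimaryTorsion 2 (ZMod 2) :=
  IsPrimaryTorsion.of_forall_nsmul_eq_zero (r := 1) (by decide)

/-- **`H^q(S, V) = 0` for `q > cd₂(N)`**: `V|_S` is a retract (indeed isomorphic image) of the induced
module `M_S^N(𝔽₂)`, whose cohomology is `H^q(N, 𝔽₂) = 0` by Shapiro's lemma.
[cite: SerreGaloisCohomology1997, I §2.5 Prop. 10] -/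
theorem subsingleton_H_restrict_stabilizer (h : IsKleinFour M P₁ P₂) {τ : G} (hτ₁ : ρ τ P₁ = P₂)
    (hτ₂ : ρ τ P₂ = P₁) {n : ℕ} (hcd : GroupCdLE ρ.ker 2 n) {q : ℕ} (hq : n < q) :
    Subsingleton ((ρ.restrict (subgroupIncl (stabilizerSubgroup ρ (P₁ + P₂)))).H q) := by
  haveI := compactSpace_stabilizerSubgroup ρ (P₁ + P₂)
  have hcdT : GroupCdLE (kerInStab ρ (P₁ + P₂)) 2 n := hcd.of_continuousMulEquiv (kerEquivKerInStab ρ _)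
  haveI : IsClosed (kerInStab ρ (P₁ + P₂) : Set (stabilizerSubgroup ρ (P₁ + P₂))) :=
    isClosed_kerInStab ρ _
  haveI : Subsingleton (continuousCohomology q (trivKer ρ (P₁ + P₂)).toTopRep) :=
    hcdT (ZMod 2) (trivKer ρ (P₁ + P₂)) isPrimaryTorsion_zmod_two hq
  haveI : Subsingleton (continuousCohomology q (coindRep (trivKer ρ (P₁ + P₂))).toTopRep) :=
    (shapiroAddEquiv (trivKer ρ (P₁ + P₂)) q).injective.subsingleton
  exact subsingleton_continuousCohomology_of_continuousMulEquiv
    (ContinuousMulEquiv.refl (stabilizerSubgroup ρ (P₁ + P₂))) (toCoindHom ρ h) (ofCoindHom ρ h hτ₁ hτ₂)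
    (ofCoind_toCoind ρ h hτ₁ hτ₂) q

/-- **`H³(G, V) = 0` for a Klein four-group module without fixed points, with a transposition, above
`cd₂` of the kernel.**  Let the profinite group `G` act continuously on the discrete Klein four-group
`V = {0, P₁, P₂, P₁ + P₂}` with no non-zero `G`-fixed vector, let `τ ∈ G` swap `P₁` and `P₂`, and suppose
`cd₂(N) ≤ 2` for the kernel `N` of the action.  Then `H³(G, V) = 0`: the restriction to
`S = Stab(P₁ + P₂)` vanishes (`subsingleton_H_restrict_stabilizer`), so `3 x = (G : S) x = 0`
(Serre I §2.4 Prop. 9), and `2 x = 0`. [cite: SerreGaloisCohomology1997, I §2.4 Prop. 9 and §2.5 Prop. 10] -/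
theorem subsingleton_H_three_of_kleinFour (h : IsKleinFour M P₁ P₂)
    (h0 : ∀ m : M, m ≠ 0 → ∃ g : G, ρ g m ≠ m) {τ : G} (hτ₁ : ρ τ P₁ = P₂) (hτ₂ : ρ τ P₂ = P₁)
    (hcd : GroupCdLE ρ.ker 2 2) : Subsingleton (ρ.H 3) := by
  refine subsingleton_of_forall_eq 0 fun x => ?_
  haveI := subsingleton_H_restrict_stabilizer ρ h hτ₁ hτ₂ hcd (show 2 < 3 by norm_num)
  have hres : ρ.Hpullback (subgroupIncl (stabilizerSubgroup ρ (P₁ + P₂))) 3 x = 0 :=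
    Subsingleton.elim _ _
  have h3 : (stabilizerSubgroup ρ (P₁ + P₂)).index • x = 0 :=
    index_smul_eq_zero_of_Hpullback_eq_zero_int ρ (isOpen_stabilizerSubgroup ρ _) 3 x hres
  rw [index_stabilizerSubgroup_eq_three ρ h h0 hτ₁ hτ₂] at h3
  have h2 : 2 • x = 0 := nsmul_continuousCohomology_three_eq_zero_of_forall ρ.toTopRep h.two_nsmul x
  have h3' : (2 + 1) • x = 0 := h3
  rwa [succ_nsmul, h2, zero_add] at h3'

end Main


end Summit.BirchSwinnertonDyer.BirchSwinnertonDyer.Theorems.SignedEC.KleinFour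

end
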